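import Summits.QuantumFields.BalabanUV.T4Continuum.Support.B13StepOfRecordTermData

/-!
# NE5 ∕ U3 — term-format slots, part 3: the cores' two displayed history-side inputs (`refF`, the (2.15)-sizes) READ OFF route P2's ONE
# one-run reference-data shape `RefAt` — so that, for the `act` slot of record in (2.14)-term format, route P1's END and route P2's slot
# theorem consume the SAME displayed one-run data (row O1-d2 follower; parts 1–2 = `B13TermData` p212301, `B13StepOfRecordTermData` p212552)

Cell `pub-balaban`, unit `b2b-balaban-t4-ne5-formalise-leaf-08` (NE5 formalisation swarm, LEAF PROVER 08, gen 2; row O1-d2 holder).  Summits-side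
bookkeeping under the LEAN PLACEMENT RULE (NOT a Literature module).  HONEST FRAMING: rung (B)+1 of the FINITE-VOLUME T⁴ continuum programme —
NOT infinite volume, NOT a mass gap, NOT the Clay problem, NOT a proof of NE5 (NOT PRINTED; cell GAPS G-t4-U3-1).  HONEST DEPENDENCY (cell line,
verbatim): continuum YM on T⁴ ⇐ BetaPertH ∧ nine spine estimates (0/9 proved); BetaPertH ⇐ (D1) ∧ (D4) ∧ CAP+tail; G-an2-4 gates asym, D1
and NE2/3/4.

WHAT.  Part 2's END application `exists_ne5_of_record_secant_termData` displays, about the term CORES, exactly two history-side inputs: the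
one-run integrability `refF` of every factor's tilted integrand at the class points and the (2.15)-sizes `‖z(q.1)⁻¹‖·∫‖F q‖ dν ≤ A`.  Route P2's
term model (`ActivityTermDatum`, p195577) displays ONE one-run shape per term and input point, `TermDatum.RefAt 𝔠 pt` («Base membership of the
term model»; printed KIND: [Balaban1988RG2Cluster] (2.15)–(2.26) pp. 15–18 bound ONE run's kernels, Gaussian integrals and normalisations at
its own data — locator only, asserted nowhere), from which `ActivityTermSlot.norm_term_le` reads the size `‖term pt‖ ≤ 𝔠.size = M′∕ζ`.  Here:
* §0 `invNorm_mul_integral_norm_F_le` — the L¹ form of that size bound, `‖(z pt.1)⁻¹‖·∫‖F pt‖ dν ≤ 𝔠.size`, from `Admissible 𝔠` + `RefAt 𝔠 pt`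
  (same two steps: `e^{u′P} ≥ 1` since `u′ ≥ 0`, `P ≥ 0`; `‖z‖ ≥ ζ > 0`); `size_nonneg`.
* §1 (generic carriers, any term indexing) under the section binders `hrH` (positive margins), `hadm : ∀ Z j, (𝔡 Z j).Admissible` and
  `hRef` = `RefAt (𝔡 Z j) q` for every factor `(Z, j)` of every tuple localizing at a step-`k` domain, at every class point `q` (INLINE, no
  Prop-def): `refF_of_refAt` (the field `hF`; part 1's `linearHistoryOn_termData` ∕ `actExpLinearOn_termData` ∕ `actExpNormBound_termData` then
  apply with `refF := refF_of_refAt …` — not restated), **`actAbsBound_termData_of_refAt`** with `A := fun _ _ _ Z j => (𝔡 Z j).size`.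
* §2 on the model of record: **`exists_ne5_of_record_secant_termData_of_refAt`** — part 2's END application with `refF`, `hA`, `hA0` REPLACED by
  `hadm` + `hRef`; what the history half of W2 then displays about the cores is the (2.38)-KIND DECAY OF THE SIZES against a stripped `A′`
  (`(𝔡 Z ℓ).size ≤ A′·e^{−ϰ(d(Z)+5)}`) with leaf-08's anchored exponential norm `Φ′` of `A′` (`36Φ′ < 1`) and the per-term number `N̄`; every
  other binder is leaf-01's (p211635) verbatim.
Nothing of [II] is asserted; no END module is edited; `BetaPertH`, (B), (B^μ) absent.  0 sorry; axioms ⊆ {propext, Classical.choice, Quot.sound}.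
-/

noncomputable section

open MeasureTheory
open scoped BigOperators

namespace Summit.QuantumFields.BalabanUV.T4Continuum.B13TermDataRefAt

open Literature.MathematicalPhysics.QuantumFieldTheory.Balaban1983to89
open Literature.MathematicalPhysics.QuantumFieldTheory.Balaban1983to89.T4OutputRate (Carriers DecayBound NE5)
open Literature.MathematicalPhysics.QuantumFieldTheory.Balaban1983to89.T4InputCauchyRateSpecies (ballClass OpLipschitz)
open Literature.MathematicalPhysics.QuantumFieldTheory.Balaban1983to89.T4ActivityTilt (domForm domForm_nonneg)
open Summit.QuantumFields.BalabanUV.T4Continuum.ActivityTermModel (TermDatum TermConsts)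
open Summit.QuantumFields.BalabanUV.T4Continuum.B13OpDatum (Format OpDatum entry Species B13Weights)
open Summit.QuantumFields.BalabanUV.T4Continuum.B13OpDatumJunctions (RawBounded WeightedEntrywiseRate)
open Summit.QuantumFields.BalabanUV.T4Continuum.B13HistDatum (level136)
open Summit.QuantumFields.BalabanUV.T4Continuum.B13HistMeasurable (MeasPotFrame B13HistM)
open Summit.QuantumFields.BalabanUV.T4Continuum.B13StepTermFamily (TermIndexing ActExpLinearOn)
open Summit.QuantumFields.BalabanUV.T4Continuum.B13StepTermExpLinear (actOf dataOf LinearHistoryOn)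
open Summit.QuantumFields.BalabanUV.T4Continuum.B13TermHistSecant (ActExpNormBound ActAbsBound)
open Summit.QuantumFields.BalabanUV.T4Continuum.B13Carriers (TwoRuns)
open Summit.QuantumFields.BalabanUV.T4Continuum.B13StepTermLabels (TermIdx InnerLabel)
open Summit.QuantumFields.BalabanUV.T4Continuum.B13StepTermSocket (labelsIndexing)
open Summit.QuantumFields.BalabanUV.T4Continuum.B13InnerData (Bnd b13InnerData)
open Summit.QuantumFields.BalabanUV.T4Continuum.B13ActMajorantLevels (polyWeight)
open Summit.QuantumFields.BalabanUV.T4Continuum.UrsellTreeSum (ind)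
open Summit.QuantumFields.BalabanUV.T4Continuum.B13Base (selfCtr)
open Summit.QuantumFields.BalabanUV.T4Continuum.B13DomainGeometryTR (SCube footprint)
open Summit.QuantumFields.BalabanUV.T4Continuum.B13StepOfRecord (Slots assembly step outA outB)
open Summit.QuantumFields.BalabanUV.T4Continuum.B13TermData
  (TermCore termData histLs margins linearHistoryOn_termData actExpLinearOn_termData actExpNormBound_termData actAbsBound_termData)
open Summit.QuantumFields.BalabanUV.T4Continuum.B13StepOfRecordTermData (TermSlots)

/-! ## §0 The L¹ size of one term from its reference data (route P2's `RefAt`, `Admissible`, `size`) -/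

section OneTerm

variable {Op Hist ι κ S Ω Ω₀ 𝒴 𝒞 : Type*} [Fintype ι] [Fintype κ] [DecidableEq ι] [DecidableEq κ] [MeasurableSpace Ω]
  [MeasurableSpace Ω₀]

/-- [folklore] The size constant `M′∕ζ` is nonnegative on the admissible range. -/
theorem size_nonneg {𝔠 : TermConsts} (hadm : 𝔠.Admissible) : 0 ≤ 𝔠.size := div_nonneg hadm.hM' hadm.hζ.le

/-- [folklore] **THE L¹ SIZE OF A TERM AT A POINT CARRYING REFERENCE DATA**: `‖z(pt.1)⁻¹‖·∫‖F pt‖ dν ≤ M′∕ζ` — the two steps of route P2's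
`ActivityTermSlot.norm_term_le` (the exponential-moment majorant `e^{u′P} ≥ 1` since `u′ ≥ 0` on the admissible range and `P = domForm ≥ 0`;
the normalisation's modulus `‖z‖ ≥ ζ > 0`), stated BEFORE the triangle inequality so that it feeds leaf-03's absolute-majorant binder.
(Candidate for `ActivityTermSlot`; kept here with this note.) -/
theorem invNorm_mul_integral_norm_F_le (𝔱 : TermDatum Op Hist ι κ S Ω Ω₀ 𝒴 𝒞) {𝔠 : TermConsts} (hadm : 𝔠.Admissible) {pt : Op × Hist}
    (href : 𝔱.RefAt 𝔠 pt) : ‖(𝔱.z pt.1)⁻¹‖ * ∫ x, ‖𝔱.F pt x‖ ∂𝔱.ν ≤ 𝔠.size := by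
  have hu' : 0 ≤ 𝔠.u' := by
    have := hadm.hu; have := hadm.hκQ; have := hadm.hW; have := hadm.hKk
    have hcG : 0 ≤ 𝔠.cG := le_trans (by
      have := hadm.hm; have := hadm.hκL; have := hadm.hcP; have := hadm.hc; have := hadm.hκA; have := hadm.hκP
      have := hadm.hK
      have hc'0 : 0 ≤ 𝔠.c' := le_trans (div_nonneg hadm.hc (by linarith [hadm.hsA])) hadm.hc'
      have hcP'0 : 0 ≤ 𝔠.cP' := le_trans (div_nonneg hadm.hcP (by linarith [hadm.hsP])) hadm.hcP'
      positivity) hadm.hcG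
    have := mul_nonneg (mul_nonneg hadm.hκQ hadm.hW) hadm.hKk
    linarith [hadm.huu']
  have hIF : ∫ x, ‖𝔱.F pt x‖ ∂𝔱.ν ≤ 𝔠.M' := by
    refine le_trans (integral_mono_of_nonneg (Filter.Eventually.of_forall fun x => norm_nonneg _) href.hI'
      (Filter.Eventually.of_forall fun x => ?_)) href.hM'
    have h1 : 1 ≤ Real.exp (𝔠.u' * domForm (𝔱.Xf x) (𝔱.Bf x)) := Real.one_le_exp (mul_nonneg hu' (domForm_nonneg _ _))
    simpa using mul_le_mul_of_nonneg_right h1 (norm_nonneg (𝔱.F pt x))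
  have hzpos : 0 < ‖𝔱.z pt.1‖ := lt_of_lt_of_le hadm.hζ href.hζ
  unfold TermConsts.size
  rw [norm_inv, div_eq_inv_mul]
  exact mul_le_mul ((inv_le_inv₀ hzpos hadm.hζ).2 href.hζ) hIF (integral_nonneg fun _ => norm_nonneg _) (inv_nonneg.2 hadm.hζ.le)

end OneTerm

/-! ## §1 The cores' displayed inputs read off `RefAt` — any carriers, any term indexing -/

section Generic

variable {C : Carriers} {P : MeasPotFrame C} {𝒴 : Type*} {dom : 𝒴 → C.Dom} {T κ ι Ω Ω₀ 𝒞 S J : Type*} [MeasurableSpace Ω]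
  [MeasurableSpace Ω₀] [Fintype ι] [Fintype κ] [DecidableEq ι] [DecidableEq κ] {ιT : Type*} (𝒯 : TermIndexing C ιT C.Dom J)
  (F : ℕ → Format (Species T κ ι Ω 𝒴)) (G : ℕ → B13Weights κ ι S 𝒴) (rH : ℕ → ℝ) (𝔗 : C.Dom → J → TermCore P dom T κ ι Ω Ω₀ 𝒞)
  (𝔡 : C.Dom → J → TermConsts)
  {K : ℕ → (ℕ → ℝ) → C.BgB → Set (OpDatum (Species T κ ι Ω 𝒴) × B13HistM P)} {W : Set (ℕ → ℝ)}

/-! SECTION BINDERS (included below): positive margins `hrH`; admissible term constants `hadm`; and `hRef` — route P2's ONE one-run shape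
`RefAt (𝔡 Z j) q` (printed KIND (2.15)–(2.26), locator only, asserted nowhere) for every factor `(Z, j)` of every tuple localizing at a step-`k`
domain, at every class point `q` of step `k`. -/
variable (hrH : ∀ k, 0 < rH k) (hadm : ∀ Z j, (𝔡 Z j).Admissible)
  (hRef : ∀ k, ∀ g ∈ W, ∀ (U : C.BgB) (q : OpDatum (Species T κ ι Ω 𝒴) × B13HistM P), q ∈ K k g U →
    ∀ X : C.Dom, C.scale X = k → ∀ i, 𝒯.Rel k i X → ∀ m,
      (termData F G rH 𝔗 (𝒯.poly i m) (𝒯.lab i m)).RefAt (𝔡 (𝒯.poly i m) (𝒯.lab i m)) q)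
include hRef

/-- [folklore] **PART 1's BINDER `refF` IS THE FIELD `hF` OF ROUTE P2's `RefAt`.** -/
theorem refF_of_refAt :
    ∀ k, ∀ g ∈ W, ∀ (U : C.BgB) (q : OpDatum (Species T κ ι Ω 𝒴) × B13HistM P), q ∈ K k g U →
      ∀ X : C.Dom, C.scale X = k → ∀ i, 𝒯.Rel k i X → ∀ m,
        Integrable ((termData F G rH 𝔗 (𝒯.poly i m) (𝒯.lab i m)).F q) (𝔗 (𝒯.poly i m) (𝒯.lab i m)).ν :=
  fun k g hg U q hq X hX i hi m => (hRef k g hg U q hq X hX i hi m).hF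

include hrH hadm

/-! (The structure theorems `linearHistoryOn_termData` ∕ `actExpLinearOn_termData` ∕ `termHistExpLinear_termData` ∕ `actExpNormBound_termData` of
part 1 are applied with `refF := refF_of_refAt …` directly — no restatement here, by the dedup rule.) -/


/-- [folklore] **LEAF-03's ABSOLUTE-MAJORANT BINDER WITH THE SIZES `M′∕ζ` OF ROUTE P2's TERM CONSTANTS**: from `hrH` + `Admissible` + `RefAt` at
the class points, `ActAbsBound 𝒯 (dataOf …) K W (fun _ _ _ Z j => (𝔡 Z j).size)` (§0 + part 1's `actAbsBound_termData`). -/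
theorem actAbsBound_termData_of_refAt :
    ActAbsBound 𝒯 (dataOf (termData F G rH 𝔗) (histLs 𝔗)) K W (fun _ _ _ Z j => (𝔡 Z j).size) :=
  actAbsBound_termData 𝒯 F G rH 𝔗 hrH (refF_of_refAt 𝒯 F G rH 𝔗 𝔡 hRef) fun k g hg U q hq X hX i hi m =>
    invNorm_mul_integral_norm_F_le _ (hadm _ _) (hRef k g hg U q hq X hX i hi m)

end Generic

/-! ## §2 On the model of record: the secant END for term-format slots with the cores' inputs read off `RefAt` -/

section OfRecord

variable {𝔾 : Type} [GaugeGroup 𝔾] {R : TwoRuns 𝔾} {P : MeasPotFrame R.carriers} {𝒴 : Type*} {dom : 𝒴 → R.carriers.Dom}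
  {T κ ι S Ω Ω₀ 𝒞 IOp : Type*} [MeasurableSpace Ω] [MeasurableSpace Ω₀] [Fintype ι] [Fintype κ] [DecidableEq ι] [DecidableEq κ]
  (𝔖 : TermSlots R P dom T κ ι S Ω Ω₀ 𝒞 IOp) (𝔡 : R.carriers.Dom → InnerLabel R.carriers.Dom (Bnd R) → TermConsts) (E₀ cB : ℝ)

/-- [folklore] **THE SECANT END ON THE CARRIERS OF RECORD FOR TERM-FORMAT SLOTS, THE CORES' INPUTS READ OFF ROUTE P2's REFERENCE DATA** —
part 2's `exists_ne5_of_record_secant_termData` (hence leaf-01's `exists_ne5_of_record_secant_actNormDecay`, p211635) with `refF := refF_of_refAt`,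
`hA := actAbsBound`-sizes `(𝔡 Z ℓ).size` (§0), `hA0 := size_nonneg`.  DISPLAYED about the cores: admissible term constants `𝔡 Z ℓ`, route P2's
`RefAt (𝔡 Z ℓ) q` at the points of the budget ball class (ONE one-run shape, printed KIND (2.15)–(2.26)), the (2.38)-KIND decay of the SIZES
against a stripped `A′` and the anchored exponential norm `Φ′` of `A′` (`36Φ′ < 1`), the per-term number `N̄`; every other binder is leaf-01's
verbatim (reading, slice budgets, L05∕L06, W1 entry rate, W4, `OpLipschitz` — the O2-op wall —, radii, signs, smallness; NE5 rate `ϰ`). NOT a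
proof of NE5. -/
theorem exists_ne5_of_record_secant_termData_of_refAt {W : Set (ℕ → ℝ)} {ROp RHist : ℕ → ℝ}
    {A' : ℕ → (ℕ → ℝ) → R.carriers.BgB → R.carriers.Dom → InnerLabel R.carriers.Dom (Bnd R) → ℝ}
    {ϰ Λop Nbar Φ' EA₀ cA c₁ r₀ δ' θ θ' ρ₀ : ℝ}
    (hadm : ∀ Z ℓ, (𝔡 Z ℓ).Admissible)
    (hRef : ∀ k, ∀ g ∈ W, ∀ (U : R.carriers.BgB) (q : OpDatum (Species T κ ι Ω 𝒴) × B13HistM P),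
      q ∈ ballClass (selfCtr (assembly 𝔖.toSlots).raw (assembly 𝔖.toSlots).histRef) ROp RHist k g U →
      ∀ X : R.carriers.Dom, R.carriers.scale X = k →
        ∀ i : TermIdx R.carriers.Dom (Bnd R), (labelsIndexing (B13DomainGeometryTR.domainGeometry R) (b13InnerData R)).Rel k i X →
          ∀ m, (termData 𝔖.F 𝔖.G 𝔖.rHist 𝔖.core
              ((labelsIndexing (B13DomainGeometryTR.domainGeometry R) (b13InnerData R)).poly i m)
              ((labelsIndexing (B13DomainGeometryTR.domainGeometry R) (b13InnerData R)).lab i m)).RefAt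
            (𝔡 ((labelsIndexing (B13DomainGeometryTR.domainGeometry R) (b13InnerData R)).poly i m)
              ((labelsIndexing (B13DomainGeometryTR.domainGeometry R) (b13InnerData R)).lab i m)) q)
    (hNbar0 : 0 ≤ Nbar)
    (hNle : ∀ k (Z : R.carriers.Dom) (ℓ : InnerLabel R.carriers.Dom (Bnd R)),
      𝔖.rHist k * ∑ Y ∈ (𝔖.core Z ℓ).D, ‖(𝔖.G (R.carriers.scale Z)).τ Y‖ * level136 P.consts (R.carriers.d (dom Y)) ≤ Nbar)
    (hA0' : ∀ k g U Z ℓ, 0 ≤ A' k g U Z ℓ) (hϰ : 0 ≤ ϰ)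
    (hdec : ∀ k g U Z ℓ, (𝔡 Z ℓ).size ≤ A' k g U Z ℓ * Real.exp (-(ϰ * (R.carriers.d Z + 5))))
    (hΦ0 : 0 ≤ Φ') (hΦsmall : 36 * Φ' < 1)
    (hΦ : ∀ k, ∀ g ∈ W, ∀ (U : R.carriers.BgB) (q : SCube R),
      ∑ Z ∈ R.domAt k, ind (q ∈ footprint Z) * polyWeight (b13InnerData R) (A' k g U) k Z *
        Real.exp ((footprint Z).card) ≤ Φ')
    (hT : (assembly 𝔖.toSlots).TransportReads W)
    (hbB : (assembly 𝔖.toSlots).SliceBudgetB W ϰ cB) (hbA : 𝔖.D.SliceBudget (step 𝔖.toSlots E₀ cB) W ϰ cA)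
    (hdA : DecayBound (outA 𝔖.toSlots E₀ cB) W EA₀ ϰ) (hdB : DecayBound (outB 𝔖.toSlots E₀ cB) W E₀ ϰ)
    (hRA : RawBounded 𝔖.F (assembly 𝔖.toSlots).rawAt W) (hRB : RawBounded 𝔖.F 𝔖.rawB W)
    (hwer : WeightedEntrywiseRate 𝔖.F (assembly 𝔖.toSlots).rawAt 𝔖.rawB W c₁ fun k => θ ^ k) (hfl : ∀ k, r₀ ≤ 𝔖.rOp k)
    (hins : (step 𝔖.toSlots E₀ cB).InsertionRate W ϰ E₀ δ' θ)
    (hopL : OpLipschitz (step 𝔖.toSlots E₀ cB) W ϰ Λop ρ₀)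
    (hOp : ∀ k, c₁ / r₀ * 𝔖.rOp k ≤ ROp k) (hHist : ∀ k, (assembly 𝔖.toSlots).bHist E₀ cB k ≤ RHist k)
    (hHistA : ∀ k, δ' * 𝔖.rHist k + EA₀ * (𝔖.rHist k * (cA / (1 - 𝔖.D.ω))) ≤ RHist k)
    (hEA₀ : 0 ≤ EA₀) (hE₀ : 0 ≤ E₀) (hΛop : 0 ≤ Λop) (hcA : 0 ≤ cA) (hcB : 0 ≤ cB)
    (hc₁ : 0 ≤ c₁) (hr₀ : 0 < r₀) (hδ' : 0 ≤ δ') (hθ0 : 0 < θ) (hθ1 : θ < 1) (hθθ' : θ ≤ θ') (hθ'1 : θ' ≤ 1)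
    (hω : 0 < 𝔖.D.ω) (hω1 : 𝔖.D.ω < 1) (hρ₀ : 0 < ρ₀)
    (hsmall : 𝔖.D.ω + 2 * (Nbar * (Φ' / (1 - 36 * Φ') ^ 2)) * cA < θ') :
    ∃ C₅, NE5 (outA 𝔖.toSlots E₀ cB) (outB 𝔖.toSlots E₀ cB) W ϰ θ' C₅ :=
  𝔖.exists_ne5_of_record_secant_termData E₀ cB (refF_of_refAt _ _ _ _ _ 𝔡 hRef) hNbar0 hNle
    (fun k g hg U q hq X hX i hi m => invNorm_mul_integral_norm_F_le _ (hadm _ _) (hRef k g hg U q hq X hX i hi m))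
    (fun _ _ _ Z ℓ => size_nonneg (hadm Z ℓ)) hA0' hϰ hdec hΦ0 hΦsmall hΦ hT hbB hbA hdA hdB hRA hRB hwer hfl hins hopL hOp hHist hHistA
    hEA₀ hE₀ hΛop hcA hcB hc₁ hr₀ hδ' hθ0 hθ1 hθθ' hθ'1 hω hω1 hρ₀ hsmall

end OfRecord

end Summit.QuantumFields.BalabanUV.T4Continuum.B13TermDataRefAt

end
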